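import Literature.NumberTheory.EllipticCurves.HeegnerPointsKolyvaginPrimaryProp82Proofs
import HarnessLib

/-!
# Route `CMKolyvaginAtInertTwo`, crux `CMKolyvaginExactAtInertTwo` (stmt-BirchSwinnertonDyer-24277):
# leaf (B) of the kernel Kolyvagin machine AT `p = 2`, level `2`, in NON-EIGEN form

Seat `bsd-line-cmk2-p1` g6 (cell `bsd-print-cf2`); helper (`--supports stmt-BirchSwinnertonDyer-24277`).
THEOREMS ONLY: no definition, no named fact, no `sorry`; no item is closed; BSD is not proved by this.

WHY. The machine's leaf (B) (`lemma_5_3_descent_of_reciprocity` / `hdual_of_kolyvaginReciprocityM`: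
for a `ν`-eigenclass `d` Selmer off `λ` with `p^a d_λ` non-Selmer and `s ∈ Sel_{p^M}(E/K)^ν`,
`p^{M-1-a} s_λ = 0`) is typed `p ≠ 2`: its Step 8 splits `E_{p^M} = E⁺ ⊕ E⁻` into `τ`-eigenlines
(`RatClosure.exists_eigenvectors`, `KolyvaginEigenPow.exists_eigen_generators`). At `p = 2`, `M = 1`
the eigen-form is VOID (memo `Cruxes/CMExactDescentAtTwo/MEMO-tau-line-at-two.md` §1: for
`τ`-invariant `s` the local pairing vanishes identically). What survives — with NO eigen-hypothesis
on `s` — is exactly what the `τ`-part descent of memo §2 consumes: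

* `lemma_5_3_descent_two` — `E/ℚ` elliptic, `K` imaginary quadratic with conjugation `c`, `ℓ` a
  Kolyvagin prime of `(2, 1)` in Gross's form, `λ` good, `e` alternating left-non-degenerate on
  `E₂ = E(K̄)[2]` with the reciprocity law (R)₁ at `λ` for `(s, d)`: if the `ν`-eigenclass `d` is NOT
  in the Selmer local kernel at `λ` and `s ∈ Sel₂(E/K)` is ARBITRARY, then
  **`c_* s − s ∈ ker(H¹(K, E₂) → H¹(K_λ, E₂))`** (`(1 + τ)s` is locally trivial at `λ`).
  Steps 0–7 are the tree's odd-`p` proof VERBATIM (Frobenius lift `T` of `c`, `T² = τ'` a Frobenius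
  at `𝔔 ∣ λ` fixing `E₂`; tame values `[d, σ]`, `σ ∈ I_𝔔`, non-zero, cyclic, `T_*[d, σ] = −ν[d, σ]`).
  AT TWO: `−ν f = f` in `E₂`, so the tame generator `f = [d, σ₁] ≠ 0` is `T`-FIXED; reciprocity
  gives `e([s, τ'], f) = 0`; in `E₂ ≅ 𝔽₂²` the `e`-annihilator of `f ≠ 0` is `{0, f}`
  (`KolyvaginReciprocity.mem_zmultiples_of_pairing_eq_zero`, Gross Prop. 8.1 (2)), so `[s, τ']` is `T`-fixed; and `T_*[s, τ'] = [c_* s, τ']`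
  (`IsLiftOfAut.h1Eval_conjAct`, `conj_T τ' = τ'`), whence `[c_* s − s, τ'] = 0` and Gross's
  Prop. 9.6 (`mem_torsionLocalKer_iff_h1Eval_eq_zero`) concludes.

Use (memo §2): with `d = c(ℓ)` Kolyvagin's class at a depth-`1` prime where `y_K ∉ 2E(K_λ)` and `ℓ` from
the Čebotarev leaf at `2` (p597930) with `(c_* s − s)_λ ≠ 0`, this is the contradiction proving `τ = 1`
on `Sel₂(E/K)` when `y_K ∉ 2E(K)`. The `τ`-FIXED part of `Sel₂` is untouched (memo §1): not the crux.

References: [McCallumLMS1991] §2 Prop. 2.2, §4, §5 Lemma 5.3; [GrossLMS1991] (3.3), (7.6), Props. 8.1, 8.2, 9.6.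
-/

-- single-conjunct summit: `Summit.BirchSwinnertonDyer.BirchSwinnertonDyer.…` repeats the name by design
set_option linter.dupNamespace false
set_option autoImplicit false

noncomputable section

universe u

namespace Summit.BirchSwinnertonDyer.BirchSwinnertonDyer.Theorems.KolyvaginDescentTwo

/-! ## McCallum's Lemma 5.3 / Gross's Prop. 8.2 at `p = 2`, `M = 1`, non-eigen form -/

open scoped Classical Pointwise
open WeierstrassCurve NumberField IsDedekindDomain Field WithZero
open Literature.NumberTheory.GaloisRepresentations Literature.NumberTheory.EllipticCurves

variable (W : WeierstrassCurve ℚ) {K : Type u} [Field K] [NumberField K]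

-- one ~300-line tactic proof (the odd-`p` original runs under `maxHeartbeats 1600000`); aggregate budget only
set_option maxHeartbeats 400000 in
/-- **Leaf (B) at `p = 2`, level `2`, NON-EIGEN form** (McCallum Lemma 5.3 + Prop. 2.2 / Gross
Prop. 8.2 with the `𝔽₂²` replacement of the eigenline step): `K` imaginary quadratic (`c ≠ 1`), `ℓ` a
Kolyvagin prime of `(2, 1)` (Gross form, `q = 2`), `λ` good, `e` alternating left-non-degenerate on
`E(K̄)[2]` with (R)₁ at `λ` for `(s, d)`; if the `ν`-eigenclass `d` is NOT in the Selmer local kernel at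
`λ` and `s ∈ Sel₂(E/K)` is arbitrary, then `c_* s − s ∈ ker(H¹(K, E₂) → H¹(K_λ, E₂))`. Steps 0–7 =
the tree's `lemma_5_3_descent_of_reciprocity` verbatim; Steps 8–9 = the `p = 2` replacement.
[cite: McCallumLMS1991, §5 Lemma 5.3 (with §2 Prop. 2.2), §4]
[cite: GrossLMS1991, Prop. 8.2 (proof), Prop. 8.1, (3.3), (7.6), Prop. 9.6] -/
theorem lemma_5_3_descent_two [W.IsElliptic] (hK : IsImaginaryQuadratic K)
    {c : K ≃ₐ[ℚ] K} (hc : c ≠ 1)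
    {N ℓ : ℕ} (hℓ : IsKolyvaginPrime N W K 2 ℓ) {q : ℕ} (hq : q = 2)
    (hℓM : FrobEqFrobInfty W K q ℓ)
    (hgood : (W.baseChange K).HasGoodReductionAt hℓ.place)
    {A : Type*} [AddCommGroup A]
    (e : geomTorsion (W.baseChange K) (q : ℤ) →+
      geomTorsion (W.baseChange K) (q : ℤ) →+ A)
    (halt : ∀ x, e x x = 0) (hnd : ∀ x, (∀ y, e x y = 0) → x = 0)
    {ν : ℤ} (hν : ν = 1 ∨ ν = -1)
    {d : galH1Torsion (W.baseChange K) (q : ℤ)}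
    (hd : conjAct W c (q : ℤ) d = ν • d)
    (hdv : d ∉ selmerLocalKer (W.baseChange K) (hℓ.place.adicCompletion K) (q : ℤ))
    {s : galH1Torsion (W.baseChange K) (q : ℤ)}
    (hs : s ∈ selmerGroup (W.baseChange K) (q : ℤ))
    (hR : ∀ 𝔔 ∈ hℓ.place.primesAbove, ∀ F : absoluteGaloisGroup K, IsArithFrobAt (𝓞 K) F 𝔔 →
      F ∈ torsionFixing (W.baseChange K) (q : ℤ) →
      ∀ σ ∈ 𝔔.inertia (absoluteGaloisGroup K),
      e (h1Eval (W.baseChange K) (q : ℤ) s F)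
        (h1Eval (W.baseChange K) (q : ℤ) d σ) = 0) :
    conjAct W c (q : ℤ) s - s ∈
      (W.baseChange K).torsionLocalKer (hℓ.place.adicCompletion K) (q : ℤ) := by
  classical
  have hp : Nat.Prime 2 := Nat.prime_two
  haveI : Fact (Nat.Prime 2) := ⟨hp⟩
  have hM : 1 ≤ 1 := le_rfl
  have hq' : q = 2 ^ 1 := by rw [hq, pow_one]
  haveI : Algebra.IsQuadraticExtension ℚ K := ⟨hK.1⟩
  haveI : IsTotallyComplex K := hK.2
  set w := hℓ.place with hwdef
  have hℓprime : ℓ.Prime := hℓ.prime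
  have hq0 : q ≠ 0 := by rw [hq]; exact two_ne_zero
  have hqpos : 0 < q := Nat.pos_of_ne_zero hq0
  have hq0Z : (q : ℤ) ≠ 0 := by exact_mod_cast hq0
  -- ### Step 0: `p, q ∉ λ`, `λ` good, `v_λ(ℓ) = 1`, `#E_q = q²`, `q E_q = 0`
  have hpw' : ((2 : ℕ) : 𝓞 K) ∉ w.asIdeal :=
    not_natCast_mem_of_prime_ne hℓprime hp hℓ.2.2.2.1 w hℓ.mem_place
  have hqw' : (q : 𝓞 K) ∉ w.asIdeal := by
    rw [hq]
    exact hpw'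
  have hqw : (((q : ℕ) : ℤ) : 𝓞 K) ∉ w.asIdeal := by rwa [Int.cast_natCast]
  have hwbad : w ∉ (W.baseChange K).badPlaces (𝓞 K) := fun h ↦ h hgood
  have hπ : w.valuation K (ℓ : K) = exp (-1 : ℤ) := by
    have h1 : (ℓ : K) = algebraMap (𝓞 K) K (ℓ : 𝓞 K) := by simp
    rw [h1, HeightOneSpectrum.valuation_of_algebraMap]
    exact w.intValuation_singleton (by exact_mod_cast hℓprime.ne_zero) rfl
  have hTq : ∀ P : geomTorsion (W.baseChange K) q, q • P = 0 := fun P ↦ by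
    have := (mem_geomTorsion_iff (W.baseChange K) q _).mp P.2
    apply Subtype.ext
    rw [AddSubgroupClass.coe_nsmul, ← natCast_zsmul]
    exact this
  have hcardK : Nat.card (geomTorsion (W.baseChange K) q) = q ^ 2 :=
    card_torsionPoints_eq_sq_holds (W.baseChange K) (AlgebraicClosure K)
      (by exact_mod_cast hq0)
  -- ### Step 1: the Frobenius data of (3.2)
  obtain ⟨v, 𝔓₀, h, c₀, hℓv, h𝔓₀, hh, hc₀, hE, hKact⟩ := hℓM
  have hHi := index_range_absGaloisRestrict_eq_finrank ℚ K
  haveI hHn : ((absGaloisRestrict ℚ K).range).Normal :=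
    Subgroup.normal_of_index_eq_two (hHi.trans hK.1)
  set e₀ : K →ₐ[ℚ] AlgebraicClosure ℚ :=
    (absClosureEquiv ℚ K).symm.toAlgHom.comp
      (IsScalarTower.toAlgHom ℚ K (AlgebraicClosure K)) with he₀
  have he₀x : ∀ x : K, e₀ x = (absClosureEquiv ℚ K).symm (algebraMap K (AlgebraicClosure K) x) :=
    fun _ ↦ rfl
  have hrange : ∀ γ : absoluteGaloisGroup ℚ,
      γ ∈ Set.range (absGaloisRestrict ℚ K) ↔ ∀ x : K, γ • e₀ x = e₀ x := fun γ ↦ by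
    rw [mem_range_absGaloisRestrict_iff]
    refine forall_congr' fun x ↦ ?_
    rw [absGaloisTransport_apply, he₀x]
    constructor
    · intro h1
      apply (absClosureEquiv ℚ K).injective
      rw [AlgEquiv.apply_symm_apply]
      exact h1
    · intro h1
      rw [h1, AlgEquiv.apply_symm_apply]
  have hc₀H : c₀ ∉ Set.range (absGaloisRestrict ℚ K) :=
    hc₀.not_mem_range_absGaloisRestrict (L := K) IsTotallyComplex.isComplex
  have hhH : h ∉ (absGaloisRestrict ℚ K).range := by
    intro hmem
    have hmem' : h ∈ Set.range (absGaloisRestrict ℚ K) := hmem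
    apply hc₀H
    rw [hrange]
    intro x
    rw [← hKact e₀ x]
    exact (hrange h).mp hmem' x
  -- ### Step 2: `ℓ` unramified; the prime `𝔔 ∣ λ` and the Frobenius `τ'` with `res τ' = h²`
  have hunr : Algebra.IsUnramifiedIn (𝓞 K) v.asIdeal :=
    isUnramifiedIn_of_span_natCast_isPrime hℓprime hℓ.2.2.2.2.1 hℓv
  have hIr := inertia_le_range_absGaloisRestrict_of_isUnramifiedIn (K := K) hunr h𝔓₀
  obtain ⟨w', 𝔔, τ', hw'v, -, -, h𝔔w, h𝔔𝔓₀, hτ', hresτ'⟩ :=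
    exists_place_inert_of_not_mem_range (F := ℚ) (M := K) (hK.1 ▸ Nat.prime_two) hHn
      (hHi.trans rfl) hunr h𝔓₀ hIr hh hhH
  have hℓw' : (ℓ : 𝓞 K) ∈ w'.asIdeal := by
    have h1 : (ℓ : 𝓞 ℚ) ∈ (w'.under (𝓞 ℚ)).asIdeal := by rw [hw'v]; exact hℓv
    rw [HeightOneSpectrum.under_asIdeal, Ideal.under_def, Ideal.mem_comap, map_natCast] at h1
    exact h1
  have hw'w : w' = w := hℓ.mem_iff.mp hℓw'
  subst hw'w
  rw [hK.1] at hresτ'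
  haveI : 𝔔.IsPrime := h𝔔w.1
  -- ### Step 3: the lift `T = e h e⁻¹` of `c`; `τ'` acts on `K̄` as `T²` and fixes `E_p`
  set T := (absGaloisTransport (K := ℚ) (L := K)) h with hTdef
  have hTne : T.restrictNormal K ≠ 1 := by
    intro h1
    apply hhH
    change h ∈ Set.range (absGaloisRestrict ℚ K)
    rw [mem_range_absGaloisRestrict_iff]
    intro x
    have hx := AlgEquiv.restrictNormal_commutes T K x
    rw [h1, AlgEquiv.one_apply] at hx
    exact hx.symm
  have ht : IsLiftOfAut c T.toRingEquiv := by
    have hcard : Nat.card (K ≃ₐ[ℚ] K) = 2 := by rw [IsGalois.card_aut_eq_finrank, hK.1]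
    obtain ⟨y, -, hy⟩ := (Nat.card_eq_two_iff' (1 : K ≃ₐ[ℚ] K)).mp hcard
    rw [hy c hc, ← hy _ hTne]
    exact RatClosure.isLiftOfAut_restrictNormal_absGaloisTransport h
  have hτ'T : ∀ y : AlgebraicClosure K, (τ' : absoluteGaloisGroup K) • y = T (T y) := fun y ↦ by
    rw [← absGaloisTransport_absGaloisRestrict (K := ℚ) τ' y, hresτ', map_pow, pow_two,
      AlgEquiv.mul_apply]
  have hτ'fix : τ' ∈ torsionFixing (W.baseChange K) q := by
    rw [mem_torsionFixing_iff]
    intro Q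
    obtain ⟨P, rfl⟩ := (RatClosure.torsionEquiv (K := K) W (q : ℤ)).surjective Q
    rw [← RatClosure.torsionEquiv_smul W q τ' P, hresτ', pow_two, mul_smul, hE, hE,
      ← mul_smul, ← pow_two, hc₀.sq_eq_one, one_smul]
  -- ### Step 4: `conj_T τ' = τ'` (so that `T_*[s, τ'] = [c_* s, τ']` in Step 10)
  have hconjτ' : ht.conjGalCMH τ' = τ' := by
    refine AlgEquiv.ext fun y ↦ ?_
    change ht.conjGal τ' y = _
    rw [ht.conjGal_apply]
    change T.symm ((τ' : absoluteGaloisGroup K) • (T y)) = (τ' : absoluteGaloisGroup K) • y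
    rw [hτ'T, hτ'T, AlgEquiv.symm_apply_apply]
  -- ### Step 5: `T` and `T⁻¹` map `𝔔` into itself; conjugation by `T` preserves `I_𝔔`
  haveI : 𝔓₀.IsPrime := h𝔓₀.1
  have hh𝔓₀ : h • 𝔓₀ = 𝔓₀ := MulAction.mem_stabilizer_iff.mp hh.mem_stabilizer
  have hTint : ∀ y : AlgebraicClosure K, IsIntegral (𝓞 K) y →
      IsIntegral (𝓞 K) (T y) ∧ IsIntegral (𝓞 K) (T.symm y) := fun y hy ↦ by
    have hyZ : IsIntegral ℤ y := isIntegral_trans (R := ℤ) (A := 𝓞 K) y hy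
    exact ⟨(hyZ.map T.toRingEquiv.toRingHom.toIntAlgHom).tower_top,
      (hyZ.map T.symm.toRingEquiv.toRingHom.toIntAlgHom).tower_top⟩
  have hTmap1 : ∀ (γ : absoluteGaloisGroup ℚ) (x : absIntegers (𝓞 ℚ) ℚ),
      (absGaloisTransport (K := ℚ) (L := K)) γ (absIntegersMap ℚ K x : AlgebraicClosure K) =
        absIntegersMap ℚ K (γ • x) := fun γ x ↦ by
    rw [coe_absIntegersMap, coe_absIntegersMap, absGaloisTransport_absClosureEmbedding,
      integralClosure.coe_smul]
  have hTmap : ∀ x : absIntegers (𝓞 ℚ) ℚ,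
      T (absIntegersMap ℚ K x : AlgebraicClosure K) = absIntegersMap ℚ K (h • x) ∧
      T.symm (absIntegersMap ℚ K x : AlgebraicClosure K) = absIntegersMap ℚ K (h⁻¹ • x) := by
    intro x
    refine ⟨hTmap1 h x, ?_⟩
    have h3 := hTmap1 h (h⁻¹ • x)
    rw [smul_inv_smul] at h3
    rw [← h3, ← hTdef, AlgEquiv.symm_apply_apply]
  have hmem𝔔 : ∀ x : absIntegers (𝓞 ℚ) ℚ, absIntegersMap ℚ K x ∈ 𝔔 ↔ x ∈ 𝔓₀ := fun x ↦ by
    rw [← Ideal.mem_comap, h𝔔𝔓₀]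
  have hT𝔔 : ∀ (y : absIntegers (𝓞 K) K), y ∈ 𝔔 →
      (⟨T y, (hTint y y.2).1⟩ : absIntegers (𝓞 K) K) ∈ 𝔔 ∧
      (⟨T.symm y, (hTint y y.2).2⟩ : absIntegers (𝓞 K) K) ∈ 𝔔 := by
    intro y hy
    obtain ⟨x, rfl⟩ := absIntegersMap_surjective ℚ K y
    have hx : x ∈ 𝔓₀ := (hmem𝔔 x).mp hy
    constructor
    · have : (⟨T (absIntegersMap ℚ K x), (hTint _ (absIntegersMap ℚ K x).2).1⟩ :
          absIntegers (𝓞 K) K) = absIntegersMap ℚ K (h • x) := Subtype.ext (hTmap x).1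
      rw [this, hmem𝔔, ← hh𝔓₀]
      exact Ideal.smul_mem_pointwise_smul_iff.mpr hx
    · have : (⟨T.symm (absIntegersMap ℚ K x), (hTint _ (absIntegersMap ℚ K x).2).2⟩ :
          absIntegers (𝓞 K) K) = absIntegersMap ℚ K (h⁻¹ • x) := Subtype.ext (hTmap x).2
      rw [this, hmem𝔔, ← Ideal.mem_pointwise_smul_iff_inv_smul_mem, hh𝔓₀]
      exact hx
  have hTconj : ∀ {σ : absoluteGaloisGroup K}, σ ∈ 𝔔.inertia (absoluteGaloisGroup K) →
      (ht.conjGalCMH σ : absoluteGaloisGroup K) ∈ 𝔔.inertia (absoluteGaloisGroup K) := by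
    intro σ hσ
    rw [Ideal.inertia, AddSubgroup.mem_inertia] at hσ ⊢
    intro b
    set b' : absIntegers (𝓞 K) K := ⟨T b, (hTint b b.2).1⟩ with hb'
    have h1 : σ • b' - b' ∈ 𝔔 := hσ b'
    have h2 := (hT𝔔 _ h1).2
    have heq : (ht.conjGalCMH σ : absoluteGaloisGroup K) • b - b =
        ⟨T.symm ((σ • b' - b' : absIntegers (𝓞 K) K) : AlgebraicClosure K),
          (hTint _ (σ • b' - b').2).2⟩ := by
      apply Subtype.ext
      change (((ht.conjGalCMH σ : absoluteGaloisGroup K) • b - b : absIntegers (𝓞 K) K) :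
          AlgebraicClosure K) =
        T.symm ((σ • b' - b' : absIntegers (𝓞 K) K) : AlgebraicClosure K)
      rw [AddSubgroupClass.coe_sub, AddSubgroupClass.coe_sub, integralClosure.coe_smul,
        integralClosure.coe_smul, map_sub]
      change ht.conjGal σ b - b = T.symm (σ • T b) - T.symm (T b)
      rw [ht.conjGal_apply, AlgEquiv.symm_apply_apply]
      rfl
    rw [heq]
    exact h2
  -- ### Step 6: `T⁻¹` inverts `μ_p`; the root `z = ℓ^{1/p}`; `conj_T σ` acts on `z` as `σ⁻¹`
  have hTinv : ∀ ζ : AlgebraicClosure K, ζ ^ q = 1 → T.symm ζ = ζ⁻¹ := by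
    intro ζ hζ
    obtain ⟨ζ₀, rfl⟩ := (absClosureEmbedding_bijective ℚ K).2 ζ
    have hζ₀ : ζ₀ ^ q = 1 := by
      apply (absClosureEmbedding_bijective ℚ K).1
      rw [map_pow, hζ, map_one]
    have h1 : T (absClosureEmbedding ℚ K ζ₀) = (absClosureEmbedding ℚ K ζ₀)⁻¹ := by
      rw [hTdef, absGaloisTransport_absClosureEmbedding,
        smul_eq_inv_of_smul_torsion_pow_eq W hp hM hq' hc₀ hE hζ₀, map_inv₀]
    have h2 : T (absClosureEmbedding ℚ K ζ₀)⁻¹ = absClosureEmbedding ℚ K ζ₀ := by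
      rw [map_inv₀, h1, inv_inv]
    conv_lhs => rw [← h2]
    exact AlgEquiv.symm_apply_apply T _
  obtain ⟨z, hz⟩ := IsAlgClosed.exists_pow_nat_eq (algebraMap K (AlgebraicClosure K) (ℓ : K)) hqpos
  have hz0 : z ≠ 0 := by
    intro h0
    rw [h0, zero_pow hq0, eq_comm, map_eq_zero] at hz
    exact hℓprime.ne_zero (by exact_mod_cast hz)
  have hIfix : 𝔔.inertia (absoluteGaloisGroup K) ≤ torsionFixing (W.baseChange K) q :=
    fun i hi ↦ (mem_torsionFixing_iff _ _).mpr fun P ↦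
      (W.baseChange K).smul_geomTorsion_eq_of_mem_inertia hgood hqw h𝔔w hi P
  have hIμ : ∀ {σ : absoluteGaloisGroup K}, σ ∈ 𝔔.inertia (absoluteGaloisGroup K) →
      ∀ {ζ : AlgebraicClosure K}, ζ ^ q = 1 → σ • ζ = ζ := fun hσ _ hζ ↦
    InertiaTame.smul_eq_of_mem_inertia_of_pow_eq_one w hqpos hqw' h𝔔w hσ hζ
  have hℓfix : ∀ σ : absoluteGaloisGroup K,
      σ • algebraMap K (AlgebraicClosure K) (ℓ : K) = algebraMap K (AlgebraicClosure K) (ℓ : K) :=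
    fun σ ↦ by rw [absoluteGaloisGroup.smul_def, AlgEquiv.commutes]
  have hθp : ∀ σ : absoluteGaloisGroup K, (σ • z / z) ^ q = 1 := fun σ ↦
    InertiaTame.smul_div_pow_eq_one hz hz0 (hℓfix σ)
  have hinvz : ∀ {σ : absoluteGaloisGroup K}, σ ∈ 𝔔.inertia (absoluteGaloisGroup K) →
      σ⁻¹ • z = (σ • z / z)⁻¹ * z := by
    intro σ hσ
    have h1 := InertiaTame.mul_smul_div_eq hz0 (τ := σ⁻¹) (σ' := σ) (hIμ (inv_mem hσ) (hθp σ))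
    rw [inv_mul_cancel, one_smul, div_self hz0] at h1
    have h2 : σ⁻¹ • z / z = (σ • z / z)⁻¹ := eq_inv_of_mul_eq_one_left h1.symm
    rw [← h2, div_mul_cancel₀ _ hz0]
  have hTℓ : T.symm (algebraMap K (AlgebraicClosure K) (ℓ : K)) =
      algebraMap K (AlgebraicClosure K) (ℓ : K) := by
    rw [map_natCast, map_natCast]
  have hcz : ∀ {σ : absoluteGaloisGroup K}, σ ∈ 𝔔.inertia (absoluteGaloisGroup K) →
      (ht.conjGalCMH σ : absoluteGaloisGroup K) • z = σ⁻¹ • z := by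
    intro σ hσ
    have h1 := InertiaTame.ringEquiv_apply_apply_symm_root T.symm.toRingEquiv hz hz0 hTℓ
      (fun y ↦ σ • y) (fun ζ hζ y ↦ by rw [smul_mul', hIμ hσ hζ])
    rw [hinvz hσ, ← hTinv _ (hθp σ)]
    change ht.conjGal σ z = _
    rw [ht.conjGal_apply]
    exact h1
  -- ### Step 7: the tame homomorphism `a = [d, ·]|_{I_𝔔}`: non-zero, cyclic image, `(-ν)`-eigen
  set av : 𝔔.inertia (absoluteGaloisGroup K) → geomTorsion (W.baseChange K) q :=
    fun σ ↦ h1Eval (W.baseChange K) q d σ with hav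
  have hac : Continuous av := (continuous_h1Eval _ _ d).comp continuous_subtype_val
  have haa : ∀ σ τ, av (σ * τ) = av σ + av τ := fun σ τ ↦
    h1Eval_mul (W.baseChange K) q d (hIfix σ.2) τ
  have hd0 : ∃ σ₀ : 𝔔.inertia (absoluteGaloisGroup K), av σ₀ ≠ 0 := by
    by_contra hall
    push Not at hall
    apply hdv
    rw [← oneCocycleClass_reprCocycle (W.baseChange K) q d]
    refine ((W.baseChange K).oneCocycleClass_mem_selmerLocalKer_iff hgood hqw h𝔔w
      (reprCocycle (W.baseChange K) q d)).mpr fun τ hτ ↦ ?_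
    exact hall ⟨τ, hτ⟩
  haveI : Finite (geomTorsion (W.baseChange K) q) := Nat.finite_of_card_ne_zero (by
    rw [hcardK]; exact pow_ne_zero 2 hq0)
  obtain ⟨σ₁, -, hgen⟩ :=
    InertiaTame.exists_forall_apply_eq_nsmul w hqpos hqw' hπ hz h𝔔w hTq av hac haa
  have hy₀a : av σ₁ ≠ 0 := by
    obtain ⟨σ₀, hσ₀⟩ := hd0
    intro h0
    apply hσ₀
    obtain ⟨k, hk⟩ := hgen σ₀
    rw [hk, h0, smul_zero]
  have hνν : ν * ν = 1 := by rcases hν with rfl | rfl <;> norm_num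
  have hd_eigen : ∀ σ : 𝔔.inertia (absoluteGaloisGroup K),
      ht.torsionMap W q (av σ) = -(ν • av σ) := by
    intro σ
    have hσT : (σ : absoluteGaloisGroup K) ∈ torsionFixing (W.baseChange K) q := hIfix σ.2
    have h1 := ht.h1Eval_conjAct W q d hσT
    rw [hd, h1Eval_zsmul _ _ _ _ hσT] at h1
    have h2 : av ⟨ht.conjGalCMH σ, hTconj σ.2⟩ =
        av ⟨(σ : absoluteGaloisGroup K)⁻¹, inv_mem σ.2⟩ :=
      InertiaTame.apply_eq_apply_of_smul_root_eq w hqpos hqw' hπ hz h𝔔w hTq av hac haa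
        (hcz σ.2)
    have h3 : av ⟨(σ : absoluteGaloisGroup K)⁻¹, inv_mem σ.2⟩ = -av σ :=
      h1Eval_inv (W.baseChange K) q d hσT
    change ν • av σ = ht.torsionMap W q (av ⟨ht.conjGalCMH σ, hTconj σ.2⟩) at h1
    rw [h2, h3, map_neg] at h1
    rw [h1, neg_neg]
  -- ### Step 8 (at `p = 2`, `M = 1`): `−ν f = f` in `E₂`, so the tame generator `f = [d, σ₁]` is `T`-FIXED
  set ι := ht.torsionMap W q with hιdef
  have h2T : ∀ t : geomTorsion (W.baseChange K) q, 2 • t = 0 := fun t ↦ hq ▸ hTq t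
  have hneg (t : geomTorsion (W.baseChange K) q) : -t = t := neg_eq_of_add_eq_zero_left ((two_nsmul t).symm.trans (h2T t))
  have hιf : ι (av σ₁) = av σ₁ := by
    rw [hιdef, hd_eigen σ₁]
    rcases hν with rfl | rfl
    · rw [one_smul, hneg]
    · rw [neg_smul, one_smul, neg_neg]
  -- ### Step 9 (at `p = 2`, `M = 1`): reciprocity `e([s, τ'], f) = 0` puts `[s, τ']` on the line `{0, f}`
  -- (annihilator of `f ≠ 0` in the symplectic plane `E₂`, Gross Prop. 8.1 (2)), hence `T`-fixed
  set x := h1Eval (W.baseChange K) q s τ' with hxdef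
  have hRx : e x (av σ₁) = 0 := hR 𝔔 h𝔔w τ' hτ' hτ'fix σ₁ σ₁.2
  have hιx : ι x = x := by
    obtain ⟨k, hk⟩ := AddSubgroup.mem_zmultiples_iff.mp
      (KolyvaginReciprocity.mem_zmultiples_of_pairing_eq_zero (hq ▸ hcardK) h2T e halt hnd hy₀a hRx)
    rw [← hk, map_zsmul, hιf]
  -- ### Step 10: the class `c_* s − s` and Gross's Prop. 9.6 at `λ`
  obtain ⟨s', hs'def⟩ : ∃ s' : galH1Torsion (W.baseChange K) (q : ℤ),
      conjAct W c (q : ℤ) s - s = s' := ⟨_, rfl⟩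
  have hs' : s' ∈ selmerGroup (W.baseChange K) q := by
    rw [← hs'def]
    exact sub_mem (conjAct_mem_selmerGroup W (fun w ↦ IsTotallyComplex.isComplex w) c (q : ℤ) hs) hs
  have hxs' : h1Eval (W.baseChange K) q s' τ' = 0 := by
    rw [← hs'def, ← h1EvalHom_apply _ _ hτ'fix, map_sub, h1EvalHom_apply, h1EvalHom_apply,
      ht.h1Eval_conjAct W q s hτ'fix, hconjτ', ← hιdef, ← hxdef, hιx, sub_self]
  rw [hs'def]
  haveI : CharZero (w.adicCompletion K) :=
    charZero_of_injective_algebraMap (algebraMap K (w.adicCompletion K)).injective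
  obtain ⟨𝔐, h𝔐⟩ := w.localPrimesAbove_nonempty
  have h𝔓w : w.primeBelow (closureEmb (K := K) (w.adicCompletion K)) 𝔐 ∈ w.primesAbove :=
    HeightOneSpectrum.primeBelow_mem_primesAbove h𝔐
  obtain ⟨δ, -, hF⟩ :=
    HeightOneSpectrum.exists_isArithFrobAt_conj_of_mem_primesAbove_holds h𝔔w h𝔓w hτ'
  have hFT : δ * τ' * δ⁻¹ ∈ torsionFixing (W.baseChange K) q :=
    (torsionFixing_normal (W.baseChange K) q).conj_mem _ hτ'fix δ
  have hs'w : s' ∈ selmerLocalKer (W.baseChange K) (w.adicCompletion K) (q : ℤ) :=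
    ((mem_selmerGroup_iff (W.baseChange K) q s').mp hs').1 w
  have hsunr := selmerLocalKer_le_unramifiedKer
    (HeightOneSpectrum.exists_mem_inertia_apply_eq_holds w)
    (W.baseChange K).smul_localPoints_eq_of_mem_inertia_holds hwbad hqw h𝔓w hs'w
  have hcrit := mem_torsionLocalKer_iff_h1Eval_eq_zero (W.baseChange K) (q : ℤ) h𝔐 hF hFT
    (inertia_le_torsionFixing (W.baseChange K) hwbad hqw _ h𝔐)
    (isOpen_torsionFixing (W.baseChange K) hq0Z)
    (torsionPointsMap_bijective (W.baseChange K) (w.adicCompletion K) hq0).2 hsunr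
  refine hcrit.mpr ?_
  rw [h1Eval_conj (W.baseChange K) q s' δ hτ'fix, hxs', smul_zero]

end Summit.BirchSwinnertonDyer.BirchSwinnertonDyer.Theorems.KolyvaginDescentTwo

end
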